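import Summits.FinalStateConjecture.FinalStateConjecture.Theorems.ZeroEnergyKerrOrBombSymplecticDualOfTheBombDefs2
import Summits.FinalStateConjecture.FinalStateConjecture.Theorems.ZeroEnergyKerrOrBombStationaryLimitReductionChartTransferKit
import Summits.FinalStateConjecture.FinalStateConjecture.Theorems.ZeroEnergyKerrOrBombStationaryLimitReductionKerrSchildSlabs
import HarnessLib

/-!
# Route ZeroEnergyKerrOrBomb · crux `StationaryLimitReduction` (stmt-FinalStateConjecture-10021), line
# `symplectic-dual-of-the-bomb` — the recut sets, the `N = 0` case of `stub_recutCovering`, and the reach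
# of the r3 exhaustiveness clause

Helper file (`--supports stmt-FinalStateConjecture-10021`; registered helpers `recutImage_eq_image`,
`stub_recutCovering_of_N_eq_zero`, `reach_of_hasExhaustiveDocCharts`) from the lead's wave-2 stub worker
for `stub_recutCovering` (reshape r3; lead prover-line-stmt-FinalStateConjecture-10021-a1-0, 2026-08-16),
whose registered text asks for the causal covering clauses `KerrSchildRecutCovering 𝒟 d M a Θ` of the
naive Kerr–Schild recut of a stationary decomposition `d` (vocabulary: `…SymplecticDualOfTheBombDefs2`,
p114429). The stub itself is a junction / horizon-normalisation theorem absent from tree and print; this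
file lands the closed bookkeeping around it and two one-line consequences of the r3 hypotheses used by the
worker's soundness audit:

* §1 `recutImage_eq_image`: the recut sets of Defs2 (stated through the old charts, `recutImage`) are
  images under the recut chart functions `y ↦ ψᵢ ⟨recutMap Θᵢ y, hmaps i y.2⟩` appearing in clause (i) of
  `KerrSchildRecutCovering` (general-`S` form; the `val '' S` form and the four set identities are in the
  sibling file `…KerrSchildRecut.lean` of the chartTransfer worker).
* §2 `stub_recutCovering_of_N_eq_zero`: with no hole the registered text holds (`τ₀' := τ₀`:
  `recutCharted τ₀ = docCharted d`, `(init)` = `diff_subset_causalPast`, `(ii)` = clause (ii) of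
  `HasExhaustiveDocCharts d`).
* §3 `recut_mapsTo` (the binder `hmaps` is inhabited under `IsKerrChartedWith`);
  `reach_of_hasExhaustiveDocCharts` (r3 analogue of `reach_of_hasExhaustiveCharts`, p104896): under
  `HasExhaustiveDocCharts d` EVERY point of `O`, hence every late chart point, collar points behind the
  model horizon included (`IsLateChart.image_subset` types the hole charts as late charts INTO `O` on their
  whole late region), lies in `J⁻` of the d.o.c.-certified slab at every late enough chart time; and
  `lateRegion_image_subset_chronologicalPast_docCharted`: under `O = exteriorOf 𝒟 (docCharted d)` every
  late chart point is chronologically before a d.o.c.-charted point. (In the exact Kerr development no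
  black-hole point is causally before an exterior point: with collar charts neither clause has an honest
  model — recorded in the worker's report, not asserted here.)
* §4 `recutCharted_subset_docCharted`, `exteriorOf_recutCharted_subset`: given tilt bounds `Lᵢ` of the `Θᵢ`
  on the whole Kerr exteriors (the sibling's `kerrChartedWith_tilt_bound`), for every recut time
  `τ₀' ≥ τ₀ + ∑ᵢ |(τ₀ + Lᵢ)/cᵢ − τ₀|`: `recutCharted τ₀' ⊆ docCharted d` (anchor clause of `IsKerrChartedWith`),
  hence `O' := exteriorOf 𝒟 (recutCharted τ₀') ⊆ exteriorOf 𝒟 (docCharted d) = O`.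

Elementary; no named fact, nothing restated. References: Dafermos–Luk arXiv:1710.01722, Conjecture 1
(b)–(c); O'Neill 1983, Ch. 14, pp. 402–403.
-/

set_option linter.dupNamespace false

noncomputable section

open scoped Manifold ContDiff Topology ENNReal
open Set Filter Function Literature.Geometry.Lorentzian

namespace Summit.FinalStateConjecture.FinalStateConjecture.Theorems.SymplecticDualOfTheBomb

open Summit.FinalStateConjecture.FinalStateConjecture.Theorems.OneLockedExplosion

/-! ## §1 The recut sets are the sets of the recut chart functions -/

section RecutSets

variable {𝓢 : Spacetime.{0} 4} {O : Set 𝓢.carrier} {k : ℕ}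

/-- **Registered helper `recutImage_eq_image`: the recut image is the image under the recut
chart.** For `S` inside the boosted Kerr–Schild domain, `recutImage d Θ i S` (stated through the old
chart `ψᵢ`) is the image of `{y | y.1 ∈ S}` under the recut chart `y ↦ ψᵢ ⟨recutMap Θᵢ y.1, _⟩` — the
chart function of `KerrSchildRecutCovering` (i). [folklore] -/
theorem recutImage_eq_image : ∀ {𝓢 : Spacetime.{0} 4} {O : Set 𝓢.carrier} {k : ℕ} (d : StationaryFinalStateDecomposition 𝓢 O k) (M a : Fin d.N → ℝ) (Θ : Fin d.N → E4 → E4) (i : Fin d.N) (hmaps : Set.MapsTo (recutMap (d.motion i).1 (d.motion i).2 (Θ i)) ((recutBackground d M a i).domain : Set E4) ((d.background i).domain : Set E4)) {S : Set E4}, S ⊆ ((recutBackground d M a i).domain : Set E4) → recutImage d Θ i S = (fun y : (recutBackground d M a i).domain ↦ d.toOver.chart i ⟨recutMap (d.motion i).1 (d.motion i).2 (Θ i) y.1, hmaps y.2⟩) '' {y : (recutBackground d M a i).domain | y.1 ∈ S} := by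
  intro 𝓢 O k d M a Θ i hmaps S hS
  ext p
  simp only [recutImage, mem_image, mem_setOf_eq]
  constructor
  · rintro ⟨y, ⟨s, hs, hsy⟩, rfl⟩
    refine ⟨⟨s, hS hs⟩, hs, ?_⟩
    congr 1
    exact Subtype.ext hsy
  · rintro ⟨y, hy, rfl⟩
    exact ⟨⟨_, hmaps y.2⟩, ⟨y.1, hy, rfl⟩, rfl⟩

end RecutSets


/-! ## §2 The case of no hole; the binder `hmaps` -/

section NoHole

variable {𝓢 : Spacetime.{0} 4} {O : Set 𝓢.carrier} {k : ℕ}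

/-- With no hole, the recut charted late region at the old late time is the d.o.c.-charted region
(both are the radiation zone). [folklore] -/
theorem recutCharted_eq_docCharted_of_isEmpty (d : StationaryFinalStateDecomposition 𝓢 O k)
    [IsEmpty (Fin d.N)] (M a : Fin d.N → ℝ) (Θ : Fin d.N → E4 → E4) :
    recutCharted d M a Θ d.toOver.τ₀ = docCharted d := by
  simp only [recutCharted, docCharted, iUnion_of_empty, union_empty]
  rfl

/-- With no hole, the recut certified late region is the d.o.c.-certified one (flat parts only).
[folklore] -/
theorem recutCertifiedLate_eq_docCertifiedLate_of_isEmpty (d : StationaryFinalStateDecomposition 𝓢 O k)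
    [IsEmpty (Fin d.N)] (M a : Fin d.N → ℝ) (Θ : Fin d.N → E4 → E4) (R R' : Fin d.N → ℝ → ℝ)
    (τ₁ : ℝ) : recutCertifiedLate d M a Θ R' τ₁ = docCertifiedLate d R τ₁ := by
  simp only [recutCertifiedLate, docCertifiedLate, iUnion_of_empty, union_empty]

/-- With no hole, the recut certified slab is the d.o.c.-certified one (flat parts only). [folklore] -/
theorem recutCertifiedSlab_eq_docCertifiedSlab_of_isEmpty (d : StationaryFinalStateDecomposition 𝓢 O k)
    [IsEmpty (Fin d.N)] (M a : Fin d.N → ℝ) (Θ : Fin d.N → E4 → E4) (R R' : Fin d.N → ℝ → ℝ)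
    (τ₁ : ℝ) : recutCertifiedSlab d M a Θ R' τ₁ = docCertifiedSlab d R τ₁ := by
  simp only [recutCertifiedSlab, docCertifiedSlab, iUnion_of_empty, union_empty]

/-- With no hole, the covering clause of `d` at `τ₀` is the `(init)` clause of the recut at `τ₀`.
[folklore] -/
theorem diff_recutCharted_subset_of_isEmpty (d : StationaryFinalStateDecomposition 𝓢 O k)
    [IsEmpty (Fin d.N)] (M a : Fin d.N → ℝ) (Θ : Fin d.N → E4 → E4) :
    O \ recutCharted d M a Θ d.toOver.τ₀ ⊆
      𝓢.metric.causalPast 𝓢.timeOrientation (recutInitialSlabs d M a Θ d.toOver.τ₀) := by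
  have h := d.toOver.diff_subset_causalPast
  simp only [iUnion_of_empty, empty_union] at h
  simpa only [recutCharted, recutInitialSlabs, iUnion_of_empty, union_empty] using h

end NoHole

/-- **Registered helper `stub_recutCovering_of_N_eq_zero`**: the registered text of
`stub_recutCovering` with the extra hypothesis `d.N = 0`. With no hole the recut at `τ₀' := τ₀`
changes nothing: `recutCharted τ₀ = docCharted d` (the radiation zone), so `O' = O`; `(init)` is the
covering clause `diff_subset_causalPast` of `d`, and `(ii)` is clause (ii) of `HasExhaustiveDocCharts d`
(flat parts only on both sides). [folklore] -/
theorem stub_recutCovering_of_N_eq_zero : ∀ (X : Type) [TopologicalSpace X] [ChartedSpace E3 X] [IsManifold (𝓡 3) ∞ X] [T2Space X] [SecondCountableTopology X] [ConnectedSpace X] (D : InitialDataSet (𝓡 3) X) (𝒟 : VacuumCauchyDevelopment D) (O : Set 𝒟.carrier) (d : StationaryFinalStateDecomposition 𝒟.toSpacetime O 2) (M a c r₀ : Fin d.N → ℝ) (Θ : Fin d.N → E4 → E4), d.N = 0 → O = Summit.FinalStateConjecture.exteriorOf 𝒟.toCauchyDevelopment (docCharted d) → HasExhaustiveDocCharts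 d → IsHorizonNormalised d → (∀ i, (d.hole i).horizon ⊆ Set.range (d.adapted i).toFun ∧ ChartIsAsymptoticallyCartesian (d.adapted i) ∧ InTelescope (d.hole i)) → (∀ i, IsKerrChartedWith (d.hole i) (d.adapted i) (M i) (a i) (c i) (r₀ i) (Θ i)) → KerrSchildRecutCovering 𝒟 d M a Θ := by
  intro X _ _ _ _ _ _ D 𝒟 O d M a c r₀ Θ hN hO hex _ _ _ hmaps
  haveI : IsEmpty (Fin d.N) := ⟨fun i ↦ (Fin.cast hN i).elim0⟩
  obtain ⟨R, -, -, hcov⟩ := hex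
  refine ⟨d.toOver.τ₀, fun _ _ ↦ 0, le_rfl, fun i ↦ isEmptyElim i, fun i ↦ isEmptyElim i, ?_, ?_⟩
  · rw [recutCharted_eq_docCharted_of_isEmpty, ← hO, ← recutCharted_eq_docCharted_of_isEmpty d M a Θ]
    exact diff_recutCharted_subset_of_isEmpty d M a Θ
  · intro τ₁ hτ₁
    rw [recutCharted_eq_docCharted_of_isEmpty, ← hO,
      recutCertifiedLate_eq_docCertifiedLate_of_isEmpty d M a Θ R,
      recutCertifiedSlab_eq_docCertifiedSlab_of_isEmpty d M a Θ R]
    exact hcov τ₁ hτ₁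


/-! ## §3 Reach of the r3 exhaustiveness clause; the r3 exterior clause on late chart points -/

section Consequences

variable {𝓢 : Spacetime.{0} 4} {O : Set 𝓢.carrier} {k : ℕ}

/-- **The binder `hmaps` of `KerrSchildRecutCovering` is inhabited under `IsKerrChartedWith`**: the
recut map sends the boosted Kerr–Schild exterior into the moved adapted domain (`Θ` maps
`Kerr.region a r₀ ⊇ Kerr.exterior M a` into `A.domain`; conjugate by the motion). [folklore] -/
theorem recut_mapsTo (d : StationaryFinalStateDecomposition 𝓢 O k) {M a c r₀ : Fin d.N → ℝ}
    {Θ : Fin d.N → E4 → E4}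
    (hW : ∀ i, IsKerrChartedWith (d.hole i) (d.adapted i) (M i) (a i) (c i) (r₀ i) (Θ i)) (i : Fin d.N) :
    MapsTo (recutMap (d.motion i).1 (d.motion i).2 (Θ i))
      ((recutBackground d M a i).domain : Set E4) ((d.background i).domain : Set E4) := by
  obtain ⟨-, -, -, h4, -, -, h7, -⟩ := hW i
  intro x hx
  have hx' : poincareInv (d.motion i).1 (d.motion i).2 x ∈ (Kerr.region (a i) (r₀ i) : Set E4) :=
    Kerr.mem_region.2 ((max_le_max h4.le le_rfl).trans_lt (Kerr.mem_exterior.1 (mem_boostedKerrExterior.1 hx)))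
  show poincareInv (d.motion i).1 (d.motion i).2
      ((((d.motion i).1 : E4 ≃L[ℝ] E4) (Θ i (poincareInv (d.motion i).1 (d.motion i).2 x))) + (d.motion i).2) ∈
    ((d.adapted i).domain : Set E4)
  rw [poincareInv_apply_add]
  exact h7 hx'

/-- The d.o.c.-certified late region lies in the certified late region of `d.toOver` (drop the
intersections with the d.o.c. parts). [folklore] -/
theorem docCertifiedLate_subset_certifiedLate (d : StationaryFinalStateDecomposition 𝓢 O k)
    (R : Fin d.N → ℝ → ℝ) (τ₁ : ℝ) : docCertifiedLate d R τ₁ ⊆ d.toOver.certifiedLate R τ₁ := by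
  rintro p (hp | hp)
  · exact Or.inl hp
  · obtain ⟨i, x, hx, rfl⟩ := mem_iUnion.1 hp
    exact Or.inr (mem_iUnion.2 ⟨i, x, hx.1, rfl⟩)

/-- **Registered helper `reach_of_hasExhaustiveDocCharts`** (r3 analogue of
`reach_of_hasExhaustiveCharts`, p104896): if the charts of `d` exhaust `O` through their d.o.c. parts,
EVERY point of `O` — in particular every late chart point, collar points behind the model horizon
included (`FinalStateDecompositionOver.region_subset`) — lies in the causal past of the d.o.c.-certified
slab `flatChart({x⁰ = τ₁}) ∪ ⋃ᵢ chartᵢ({tᵢ = τ₁, rᵢ ≤ Rᵢ(τ₁)} ∩ docPartᵢ)` for all sufficiently late `τ₁`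
(pure logic: a point has at most one late preimage time per chart). Read against a non-degenerate
horizon this is the D1 obstruction again (worker report). [folklore] -/
theorem reach_of_hasExhaustiveDocCharts : ∀ (𝓢 : Spacetime.{0} 4) (O : Set 𝓢.carrier) (k : ℕ) (d : StationaryFinalStateDecomposition 𝓢 O k), HasExhaustiveDocCharts d → ∃ R : Fin d.N → ℝ → ℝ, ∀ p ∈ O, ∀ᶠ τ₁ in Filter.atTop, p ∈ 𝓢.metric.causalPast 𝓢.timeOrientation (docCertifiedSlab d R τ₁) := by
  intro 𝓢 O k d hex
  obtain ⟨R, -, -, hcov⟩ := hex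
  refine ⟨R, fun p hp ↦ ?_⟩
  obtain ⟨T, hT₀, hT⟩ := exists_forall_not_mem_certifiedLate d.toOver R p
  filter_upwards [eventually_gt_atTop T] with τ₁ hτ₁
  exact hcov τ₁ (lt_of_le_of_lt hT₀ hτ₁)
    ⟨hp, fun h ↦ hT τ₁ hτ₁.le (docCertifiedLate_subset_certifiedLate d R τ₁ h)⟩

/-- Chart-point form: under `HasExhaustiveDocCharts d`, every LATE CHART POINT of every hole — whether
or not it lies in the d.o.c. part — reaches arbitrarily late d.o.c.-certified slabs. [folklore] -/
theorem lateChart_reach_of_hasExhaustiveDocCharts (d : StationaryFinalStateDecomposition 𝓢 O k)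
    (hex : HasExhaustiveDocCharts d) :
    ∃ R : Fin d.N → ℝ → ℝ, ∀ i, ∀ x ∈ (d.background i).lateRegion d.toOver.τ₀, ∀ᶠ τ₁ in atTop,
      d.toOver.chart i x ∈ 𝓢.metric.causalPast 𝓢.timeOrientation (docCertifiedSlab d R τ₁) := by
  obtain ⟨R, hR⟩ := reach_of_hasExhaustiveDocCharts 𝓢 O k d hex
  exact ⟨R, fun i x hx ↦ hR _ (d.toOver.region_subset i (mem_image_of_mem _ hx))⟩

end Consequences

section Exterior

variable {X : Type} [TopologicalSpace X] [ChartedSpace E3 X] [IsManifold (𝓡 3) ∞ X]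
  [ConnectedSpace X] {D : InitialDataSet (𝓡 3) X}

/-- **The exterior clause of r3 puts every late chart point chronologically before a d.o.c.-charted
point.** If `O = J⁺(ι X) ∩ I⁻(docCharted d)`, then the late image of EVERY hole chart — collar points
behind the model horizon included (`IsLateChart.image_subset`) — lies in `I⁻(docCharted d)`. (Worker
report: in the exact Kerr development no black-hole point is in the chronological past of an exterior
point, so with a collar chart the clause has no honest model.) [folklore] -/
theorem lateRegion_image_subset_chronologicalPast_docCharted (𝒟 : CauchyDevelopment D)
    {O : Set 𝒟.carrier} {k : ℕ} (d : StationaryFinalStateDecomposition 𝒟.toSpacetime O k)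
    (hO : O = Summit.FinalStateConjecture.exteriorOf 𝒟 (docCharted d)) (i : Fin d.N) :
    d.toOver.chart i '' (d.background i).lateRegion d.toOver.τ₀ ⊆
      𝒟.metric.chronologicalPast 𝒟.timeOrientation (docCharted d) := by
  intro p hp
  have h : p ∈ O := d.toOver.region_subset i hp
  rw [hO] at h
  exact h.2

end Exterior

/-! ## §4 The recut charted region lies in the d.o.c.-charted region for late recut times (`O' ⊆ O`) -/

section RecutInside

variable {𝓢 : Spacetime.{0} 4} {O : Set 𝓢.carrier} {k : ℕ}

/-- **Tilt inclusion, hole by hole.** If the tilt of `Θᵢ` is bounded by `L` on the Kerr exterior and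
`τ₀ + L ≤ cᵢ τ₀'`, the recut late image of hole `i` after `τ₀'` lies in the old chart's image of the late
d.o.c. part (`(Θ u)⁰ ≥ cᵢ u⁰ − L > τ₀`, and `Θᵢ '' Kerr.exterior` IS the d.o.c. part by the anchor clause of
`IsKerrChartedWith`). [folklore] -/
theorem recutImage_lateRegion_subset (d : StationaryFinalStateDecomposition 𝓢 O k)
    {M a c r₀ : Fin d.N → ℝ} {Θ : Fin d.N → E4 → E4}
    (hW : ∀ i, IsKerrChartedWith (d.hole i) (d.adapted i) (M i) (a i) (c i) (r₀ i) (Θ i)) (i : Fin d.N)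
    {L τ₀' : ℝ} (hL : ∀ u ∈ (Kerr.exterior (M i) (a i) : Set E4), |Θ i u 0 - c i * u 0| ≤ L)
    (hτ : d.toOver.τ₀ + L ≤ c i * τ₀') :
    recutImage d Θ i (Subtype.val '' (recutBackground d M a i).lateRegion τ₀') ⊆
      d.toOver.chart i '' ((d.background i).lateRegion d.toOver.τ₀ ∩ docPart d i) := by
  obtain ⟨-, hc, -, -, -, -, -, -, -, h10, -⟩ := hW i
  rintro p ⟨y, ⟨x, ⟨z, hz, rfl⟩, hxy⟩, rfl⟩
  have hu : poincareInv (d.motion i).1 (d.motion i).2 z.1 ∈ (Kerr.exterior (M i) (a i) : Set E4) :=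
    mem_boostedKerrExterior.1 z.2
  have hy : poincareInv (d.motion i).1 (d.motion i).2 y.1 =
      Θ i (poincareInv (d.motion i).1 (d.motion i).2 z.1) := by
    rw [← hxy]
    exact poincareInv_apply_add _ _ _
  refine mem_image_of_mem _ ⟨?_, ?_⟩
  · show d.toOver.τ₀ < (poincareInv (d.motion i).1 (d.motion i).2 y.1) 0
    rw [hy]
    have h1 := (abs_le.1 (hL _ hu)).1
    have h2 : τ₀' < (poincareInv (d.motion i).1 (d.motion i).2 z.1) 0 := hz
    have h3 := mul_lt_mul_of_pos_left h2 hc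
    linarith
  · show ∃ h : poincareInv (d.motion i).1 (d.motion i).2 y.1 ∈ (d.adapted i).domain,
      (d.adapted i).toFun ⟨_, h⟩ ∈ (d.hole i).doc
    rw [hy]
    have hmem : Θ i (poincareInv (d.motion i).1 (d.motion i).2 z.1) ∈
        {u : E4 | ∃ h : u ∈ (d.adapted i).domain, (d.adapted i).toFun ⟨u, h⟩ ∈ (d.hole i).doc} :=
      h10 ▸ mem_image_of_mem _ hu
    exact hmem

/-- **`recutCharted τ₀' ⊆ docCharted d` for all late enough `τ₀'`**, given tilt bounds `Lᵢ` of the `Θᵢ` on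
the whole Kerr exteriors (supplied by `kerrChartedWith_tilt_bound` of the sibling file `…KerrSchildRecut.lean`):
explicitly for `τ₀' ≥ τ₀ + ∑ᵢ |(τ₀ + Lᵢ)/cᵢ − τ₀|` (flat late regions shrink; hole parts by
`recutImage_lateRegion_subset`). [folklore] -/
theorem recutCharted_subset_docCharted (d : StationaryFinalStateDecomposition 𝓢 O k)
    {M a c r₀ : Fin d.N → ℝ} {Θ : Fin d.N → E4 → E4}
    (hW : ∀ i, IsKerrChartedWith (d.hole i) (d.adapted i) (M i) (a i) (c i) (r₀ i) (Θ i)) {L : Fin d.N → ℝ}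
    (hL : ∀ i, ∀ u ∈ (Kerr.exterior (M i) (a i) : Set E4), |Θ i u 0 - c i * u 0| ≤ L i) {τ₀' : ℝ}
    (hτ : d.toOver.τ₀ + ∑ j, |(d.toOver.τ₀ + L j) / c j - d.toOver.τ₀| ≤ τ₀') :
    recutCharted d M a Θ τ₀' ⊆ docCharted d := by
  have hc : ∀ i, 0 < c i := fun i ↦ (hW i).2.1
  have hnn : 0 ≤ ∑ j, |(d.toOver.τ₀ + L j) / c j - d.toOver.τ₀| :=
    Finset.sum_nonneg fun j _ ↦ abs_nonneg _
  have hτ₀ : d.toOver.τ₀ ≤ τ₀' := (le_add_of_nonneg_right hnn).trans hτ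
  refine union_subset_union (image_mono ((Minkowski.backgroundOn d.toOver.flatDomain).lateRegion_mono hτ₀))
    (iUnion_mono fun i ↦ recutImage_lateRegion_subset d hW i (hL i) ?_)
  have hs : |(d.toOver.τ₀ + L i) / c i - d.toOver.τ₀| ≤ ∑ j, |(d.toOver.τ₀ + L j) / c j - d.toOver.τ₀| :=
    Finset.single_le_sum (f := fun j ↦ |(d.toOver.τ₀ + L j) / c j - d.toOver.τ₀|)
      (fun j _ ↦ abs_nonneg _) (Finset.mem_univ i)
  have ha := le_abs_self ((d.toOver.τ₀ + L i) / c i - d.toOver.τ₀)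
  have h1 : (d.toOver.τ₀ + L i) / c i ≤ τ₀' := by linarith
  have h2 := (div_le_iff₀ (hc i)).1 h1
  linarith [mul_comm τ₀' (c i)]

end RecutInside

section RecutExterior

variable {X : Type} [TopologicalSpace X] [ChartedSpace E3 X] [IsManifold (𝓡 3) ∞ X]
  [ConnectedSpace X] {D : InitialDataSet (𝓡 3) X}

/-- **`O' ⊆ O`.** Given tilt bounds of the `Θᵢ` on the Kerr exteriors, for every recut time
`τ₀' ≥ τ₀ + ∑ᵢ |(τ₀ + Lᵢ)/cᵢ − τ₀|` the recut exterior `O' = exteriorOf 𝒟 (recutCharted τ₀')` lies in the r3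
exterior `exteriorOf 𝒟 (docCharted d)` (`exteriorOf_mono`). [folklore] -/
theorem exteriorOf_recutCharted_subset (𝒟 : CauchyDevelopment D) {O : Set 𝒟.carrier} {k : ℕ}
    (d : StationaryFinalStateDecomposition 𝒟.toSpacetime O k) {M a c r₀ : Fin d.N → ℝ}
    {Θ : Fin d.N → E4 → E4}
    (hW : ∀ i, IsKerrChartedWith (d.hole i) (d.adapted i) (M i) (a i) (c i) (r₀ i) (Θ i)) {L : Fin d.N → ℝ}
    (hL : ∀ i, ∀ u ∈ (Kerr.exterior (M i) (a i) : Set E4), |Θ i u 0 - c i * u 0| ≤ L i) {τ₀' : ℝ}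
    (hτ : d.toOver.τ₀ + ∑ j, |(d.toOver.τ₀ + L j) / c j - d.toOver.τ₀| ≤ τ₀') :
    Summit.FinalStateConjecture.exteriorOf 𝒟 (recutCharted d M a Θ τ₀') ⊆
      Summit.FinalStateConjecture.exteriorOf 𝒟 (docCharted d) :=
  exteriorOf_mono 𝒟 (recutCharted_subset_docCharted d hW hL hτ)

end RecutExterior

end Summit.FinalStateConjecture.FinalStateConjecture.Theorems.SymplecticDualOfTheBomb

end
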